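import Summits.Ventures.YMGap.Thresholds.OneLinkLevelTwoRefined
import Summits.Ventures.YMGap.Thresholds.OneLinkLevelTwoRows
import HarnessLib

/-!
# Venture YMGap — the one-link modulus beyond first order, part 19: ROWS of the refined level-two modulus through the star
# door — `MassGapAt 4 N x` for every `N ≥ 4 / 6 / 10 / 20 / 50`

HONEST FRAMING: venture file of the cell `pub-ymgap` (QuantumFields programme), strong-coupling LATTICE statements for `SU(N)`
lattice Yang–Mills on `ℤ⁴` (Wilson action, tree coupling `N·x`, 't Hooft `x`); nothing about the continuum; no decay rate beyond
`∃ c > 0`.  OUTPUT (hypothesis-free, kernel-checked), from `oneLinkKRModulus_levelTwoR` (second order of the covariance hierarchy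
with second-order Schwinger–Dyson means; `μ₂`, `ω` of the cell note still crude) through ds-1's star door
`StarSUNLimit.star_massGapAt_of_oneLinkKRModulus` (`4·K·|x| ≤ 9/25` on the ball `R = 6|x|`):
* `levelTwoR_Dm_le`, `levelTwoRK_le`: numerical envelope of `K₂ʳ(N,R)` (decreasing in `N`, increasing in `R`; rational `q ≤ √(1/2 − R₀)`);
* `improvedThreshold_SU_levelTwoR_four (4 ≤ N) : ImprovedThreshold 4 N (33/1000)`,
  `improvedThreshold_SU_levelTwoR_six (6 ≤ N) : ImprovedThreshold 4 N (9/250)` (`0.036`),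
  `improvedThreshold_SU_levelTwoR_ten (10 ≤ N) : ImprovedThreshold 4 N (19/500)` (`0.038`; refined first order `17/500 = 0.034`),
  `improvedThreshold_SU_levelTwoR_twenty (20 ≤ N) : ImprovedThreshold 4 N (39/1000)` (`0.039`; was `7/200 = 0.035`),
  `improvedThreshold_SU_levelTwoR_fifty (50 ≤ N) : ImprovedThreshold 4 N (1/25)` (`0.040`; was `9/250 = 0.036`).
Against the sharp Bakry–Émery window `1/32`: `+22 %` (`N ≥ 10`), `+25 %` (`N ≥ 20`), `+28 %` (`N ≥ 50`); against SZZ's printed `1/48`: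
`×1.82 … ×1.92`.  Sentence-grade all-`N` rows; the cell note's full refined column (`μ₂`, `ω`, `L⁴`) would give
`≈ 0.0396 / 0.0433 / 0.0457` and is NOT claimed here.
-/

noncomputable section

open scoped Matrix ComplexConjugate BigOperators ContDiff Matrix.Norms.Frobenius
open Matrix Complex Finset MeasureTheory ProbabilityTheory
open Literature.MathematicalPhysics.QuantumFieldTheory
open Literature.MathematicalPhysics.QuantumFieldTheory.SUNBakryEmery
open Literature.MathematicalPhysics.QuantumFieldTheory.Balaban1983to89.StrongCouplingDobrushinWindow
open Literature.MathematicalPhysics.QuantumFieldTheory.Balaban1983to89.StrongCouplingKernelWindow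

namespace Summit.Ventures.YMGap.OneLinkEigen

variable {N : ℕ}

section LevelTwoRRows

open Summit.Ventures.YMGap.StarSUNLimit (star_massGapAt_of_oneLinkKRModulus)
open Summit.Ventures.YMGap.OneLinkEigenRows (casimirFactor_le)

/-- Envelope of the refined mean coefficient: `D_m(N,R) ≤ D_m(N₀,R₀)` for `N ≥ N₀ ≥ 3`, `0 ≤ R ≤ R₀ < 1/2`. [folklore] -/
theorem levelTwoR_Dm_le {N₀ : ℕ} (hN₀ : 3 ≤ N₀) (hN : N₀ ≤ N) {R R₀ : ℝ} (hR0 : 0 ≤ R) (hRR₀ : R ≤ R₀) (hR₀ : R₀ < 1 / 2) :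
    (((N : ℝ) ^ 2 / ((N : ℝ) ^ 2 - 1)) * (1 + 1 / ((N : ℝ) * ((N : ℝ) * (1 / 2 - R)))) / (1 - 2 * ((N : ℝ) ^ 2 / ((N : ℝ) ^ 2 - 1)) ^ 2 * R ^ 2)) ≤ (((N₀ : ℝ) ^ 2 / ((N₀ : ℝ) ^ 2 - 1)) * (1 + 1 / ((N₀ : ℝ) * ((N₀ : ℝ) * (1 / 2 - R₀)))) / (1 - 2 * ((N₀ : ℝ) ^ 2 / ((N₀ : ℝ) ^ 2 - 1)) ^ 2 * R₀ ^ 2)) := by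
  have h0 : (3 : ℝ) ≤ N₀ := by exact_mod_cast hN₀
  have h1 : (N₀ : ℝ) ≤ N := by exact_mod_cast hN
  have hN1 : (0 : ℝ) < (N : ℝ) ^ 2 - 1 := by nlinarith
  have hN1' : (0 : ℝ) < (N₀ : ℝ) ^ 2 - 1 := by nlinarith
  have hNpos : (0 : ℝ) < N := by linarith
  have hN₀pos : (0 : ℝ) < N₀ := by linarith
  have hC := casimirFactor_le (N₀ := N₀) (N := N) (by omega) hN
  set C : ℝ := (N : ℝ) ^ 2 / ((N : ℝ) ^ 2 - 1) with hCdef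
  set C₀ : ℝ := (N₀ : ℝ) ^ 2 / ((N₀ : ℝ) ^ 2 - 1) with hC₀def
  have hC0 : 0 ≤ C := div_nonneg (by positivity) hN1.le
  have hC₀0 : 0 ≤ C₀ := div_nonneg (by positivity) hN1'.le
  have hR₀0 : 0 ≤ R₀ := hR0.trans hRR₀
  have hT : 0 < 1 / 2 - R := by linarith
  have hT₀ : 0 < 1 / 2 - R₀ := by linarith
  have hden₀ := levelTwoR_den_pos (N := N₀) hN₀ hR₀0 hR₀
  rw [← hC₀def] at hden₀
  have hinv : 1 / ((N : ℝ) * ((N : ℝ) * (1 / 2 - R))) ≤ 1 / ((N₀ : ℝ) * ((N₀ : ℝ) * (1 / 2 - R₀))) := by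
    refine one_div_le_one_div_of_le (by positivity) ?_
    have a : (N₀ : ℝ) * (N₀ : ℝ) ≤ (N : ℝ) * N := mul_le_mul h1 h1 hN₀pos.le hNpos.le
    have b : (1 / 2 - R₀) ≤ (1 / 2 - R) := by linarith
    calc (N₀ : ℝ) * ((N₀ : ℝ) * (1 / 2 - R₀)) = (N₀ : ℝ) * N₀ * (1 / 2 - R₀) := by ring
      _ ≤ (N : ℝ) * N * (1 / 2 - R) := mul_le_mul a b hT₀.le (by positivity)
      _ = (N : ℝ) * ((N : ℝ) * (1 / 2 - R)) := by ring
  have hnum : C * (1 + 1 / ((N : ℝ) * ((N : ℝ) * (1 / 2 - R)))) ≤ C₀ * (1 + 1 / ((N₀ : ℝ) * ((N₀ : ℝ) * (1 / 2 - R₀)))) :=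
    mul_le_mul hC (by linarith) (by positivity) hC₀0
  have hnum₀ : 0 ≤ C₀ * (1 + 1 / ((N₀ : ℝ) * ((N₀ : ℝ) * (1 / 2 - R₀)))) := by positivity
  have hden : 1 - 2 * C₀ ^ 2 * R₀ ^ 2 ≤ 1 - 2 * C ^ 2 * R ^ 2 := by
    have a : C ^ 2 ≤ C₀ ^ 2 := pow_le_pow_left₀ hC0 hC 2
    have b : R ^ 2 ≤ R₀ ^ 2 := pow_le_pow_left₀ hR0 hRR₀ 2
    nlinarith [mul_le_mul a b (sq_nonneg R) (sq_nonneg C₀), sq_nonneg C, sq_nonneg R]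
  exact div_le_div₀ hnum₀ hnum hden₀ hden

set_option maxHeartbeats 400000 in
/-- **Numerical envelope of the refined level-two bracket**: for `N ≥ N₀ ≥ 3`, `0 ≤ R ≤ R₀ < 1/2` and a rational `q > 0` with
`q² ≤ 1/2 − R₀`, `K₂ʳ(N,R) ≤ K₂ʳ⁺(N₀,R₀,q)`. [folklore] -/
theorem levelTwoRK_le {N₀ : ℕ} (hN₀ : 3 ≤ N₀) (hN : N₀ ≤ N) {R R₀ q : ℝ} (hR0 : 0 ≤ R) (hRR₀ : R ≤ R₀) (hR₀ : R₀ < 1 / 2)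
    (hq : 0 < q) (hq2 : q ^ 2 ≤ 1 / 2 - R₀) :
    (N : ℝ) ^ 2 / ((N : ℝ) ^ 2 - 1) *
        (1 + ((N : ℝ) ^ 2 / (2 * ((N : ℝ) ^ 2 - 4))) * R + 2 * (((N : ℝ) ^ 2 / ((N : ℝ) ^ 2 - 1)) * (1 + 1 / ((N : ℝ) * ((N : ℝ) * (1 / 2 - R)))) / (1 - 2 * ((N : ℝ) ^ 2 / ((N : ℝ) ^ 2 - 1)) ^ 2 * R ^ 2)) * (((N : ℝ) ^ 2 / (2 * ((N : ℝ) ^ 2 - 4))) + 1 / 4) * R ^ 2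
          + 2 * ((((N : ℝ) ^ 2 / (2 * ((N : ℝ) ^ 2 - 4))) + 1 / 4) / N) * (R / Real.sqrt (1 / 2 - R))
          + ((5 * ((N : ℝ) ^ 2 / (2 * ((N : ℝ) ^ 2 - 4))) + 1 / 4) * R ^ 2 + (((N : ℝ) ^ 2 / ((N : ℝ) ^ 2 - 1)) * (1 + 1 / ((N : ℝ) * ((N : ℝ) * (1 / 2 - R)))) / (1 - 2 * ((N : ℝ) ^ 2 / ((N : ℝ) ^ 2 - 1)) ^ 2 * R ^ 2)) * (10 * ((N : ℝ) ^ 2 / (2 * ((N : ℝ) ^ 2 - 4))) + 1 / 2) * R ^ 3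
              + ((10 * ((N : ℝ) ^ 2 / (2 * ((N : ℝ) ^ 2 - 4))) + 1 / 2) / N) * (R ^ 2 / Real.sqrt (1 / 2 - R))) / (1 / 2 - R)) ≤
      ((N₀ : ℝ) ^ 2 / ((N₀ : ℝ) ^ 2 - 1)) *
        (1 + ((N₀ : ℝ) ^ 2 / (2 * ((N₀ : ℝ) ^ 2 - 4))) * R₀ + 2 * (((N₀ : ℝ) ^ 2 / ((N₀ : ℝ) ^ 2 - 1)) * (1 + 1 / ((N₀ : ℝ) * ((N₀ : ℝ) * (1 / 2 - R₀)))) / (1 - 2 * ((N₀ : ℝ) ^ 2 / ((N₀ : ℝ) ^ 2 - 1)) ^ 2 * R₀ ^ 2)) * (((N₀ : ℝ) ^ 2 / (2 * ((N₀ : ℝ) ^ 2 - 4))) + 1 / 4) * R₀ ^ 2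
          + 2 * ((((N₀ : ℝ) ^ 2 / (2 * ((N₀ : ℝ) ^ 2 - 4))) + 1 / 4) / N₀) * (R₀ / q)
          + ((5 * ((N₀ : ℝ) ^ 2 / (2 * ((N₀ : ℝ) ^ 2 - 4))) + 1 / 4) * R₀ ^ 2 + (((N₀ : ℝ) ^ 2 / ((N₀ : ℝ) ^ 2 - 1)) * (1 + 1 / ((N₀ : ℝ) * ((N₀ : ℝ) * (1 / 2 - R₀)))) / (1 - 2 * ((N₀ : ℝ) ^ 2 / ((N₀ : ℝ) ^ 2 - 1)) ^ 2 * R₀ ^ 2)) * (10 * ((N₀ : ℝ) ^ 2 / (2 * ((N₀ : ℝ) ^ 2 - 4))) + 1 / 2) * R₀ ^ 3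
              + ((10 * ((N₀ : ℝ) ^ 2 / (2 * ((N₀ : ℝ) ^ 2 - 4))) + 1 / 2) / N₀) * (R₀ ^ 2 / q)) / (1 / 2 - R₀)) := by
  have h0 : (3 : ℝ) ≤ N₀ := by exact_mod_cast hN₀
  have h1 : (N₀ : ℝ) ≤ N := by exact_mod_cast hN
  have hN4 : (0 : ℝ) < (N : ℝ) ^ 2 - 4 := by nlinarith
  have hN1 : (0 : ℝ) < (N : ℝ) ^ 2 - 1 := by nlinarith
  have hN4' : (0 : ℝ) < (N₀ : ℝ) ^ 2 - 4 := by nlinarith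
  have hN1' : (0 : ℝ) < (N₀ : ℝ) ^ 2 - 1 := by nlinarith
  have hNpos : (0 : ℝ) < N := by linarith
  have hN₀pos : (0 : ℝ) < N₀ := by linarith
  have hC := casimirFactor_le (N₀ := N₀) (N := N) (by omega) hN
  have hE := levelTwoE_le hN₀ hN
  have hDle := levelTwoR_Dm_le hN₀ hN hR0 hRR₀ hR₀
  obtain ⟨hD0, -⟩ := levelTwoR_Dm_mono (N := N) (by omega) hR0 le_rfl (lt_of_le_of_lt hRR₀ hR₀)
  set C : ℝ := (N : ℝ) ^ 2 / ((N : ℝ) ^ 2 - 1) with hCdef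
  set E : ℝ := (N : ℝ) ^ 2 / (2 * ((N : ℝ) ^ 2 - 4)) with hEdef
  set C₀ : ℝ := (N₀ : ℝ) ^ 2 / ((N₀ : ℝ) ^ 2 - 1) with hC₀def
  set E₀ : ℝ := (N₀ : ℝ) ^ 2 / (2 * ((N₀ : ℝ) ^ 2 - 4)) with hE₀def
  set D : ℝ := C * (1 + 1 / ((N : ℝ) * ((N : ℝ) * (1 / 2 - R)))) / (1 - 2 * C ^ 2 * R ^ 2) with hDdef
  set D₀ : ℝ := C₀ * (1 + 1 / ((N₀ : ℝ) * ((N₀ : ℝ) * (1 / 2 - R₀)))) / (1 - 2 * C₀ ^ 2 * R₀ ^ 2) with hD₀def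
  have hD₀0 : 0 ≤ D₀ := hD0.trans hDle
  have hC0 : 0 ≤ C := div_nonneg (by positivity) hN1.le
  have hC₀0 : 0 ≤ C₀ := div_nonneg (by positivity) hN1'.le
  have hE0 : 0 ≤ E := by positivity
  have hE₀0 : 0 ≤ E₀ := by positivity
  have hR₀0 : 0 ≤ R₀ := hR0.trans hRR₀
  have hT₀ : 0 < 1 / 2 - R₀ := by linarith
  have hT : 0 < 1 / 2 - R := by linarith
  have hsq : q ≤ Real.sqrt (1 / 2 - R) := by
    rw [show q = Real.sqrt (q ^ 2) from (Real.sqrt_sq hq.le).symm]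
    exact Real.sqrt_le_sqrt (by linarith)
  have p2 : R ^ 2 ≤ R₀ ^ 2 := pow_le_pow_left₀ hR0 hRR₀ 2
  have p3 : R ^ 3 ≤ R₀ ^ 3 := pow_le_pow_left₀ hR0 hRR₀ 3
  have q1 : R / Real.sqrt (1 / 2 - R) ≤ R₀ / q := div_le_div₀ hR₀0 hRR₀ hq hsq
  have q2 : R ^ 2 / Real.sqrt (1 / 2 - R) ≤ R₀ ^ 2 / q := div_le_div₀ (by positivity) p2 hq hsq
  have d1 : (E + 1 / 4) / N ≤ (E₀ + 1 / 4) / N₀ := div_le_div₀ (by positivity) (by linarith) hN₀pos h1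
  have d2 : (10 * E + 1 / 2) / N ≤ (10 * E₀ + 1 / 2) / N₀ := div_le_div₀ (by positivity) (by linarith) hN₀pos h1
  have t1 : E * R ≤ E₀ * R₀ := mul_le_mul hE hRR₀ hR0 hE₀0
  have t2 : 2 * D * (E + 1 / 4) * R ^ 2 ≤ 2 * D₀ * (E₀ + 1 / 4) * R₀ ^ 2 := by
    have a : 2 * D * (E + 1 / 4) ≤ 2 * D₀ * (E₀ + 1 / 4) := by
      have := mul_le_mul hDle (by linarith : E + 1 / 4 ≤ E₀ + 1 / 4) (by positivity) hD₀0
      linarith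
    exact mul_le_mul a p2 (by positivity) (by positivity)
  have t3 : 2 * ((E + 1 / 4) / N) * (R / Real.sqrt (1 / 2 - R)) ≤ 2 * ((E₀ + 1 / 4) / N₀) * (R₀ / q) :=
    mul_le_mul (by linarith) q1 (by positivity) (by positivity)
  have n1 : (5 * E + 1 / 4) * R ^ 2 ≤ (5 * E₀ + 1 / 4) * R₀ ^ 2 := mul_le_mul (by linarith) p2 (by positivity) (by positivity)
  have n2 : D * (10 * E + 1 / 2) * R ^ 3 ≤ D₀ * (10 * E₀ + 1 / 2) * R₀ ^ 3 := by
    have a : D * (10 * E + 1 / 2) ≤ D₀ * (10 * E₀ + 1 / 2) := by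
      have := mul_le_mul hDle (by linarith : 10 * E + 1 / 2 ≤ 10 * E₀ + 1 / 2) (by positivity) hD₀0
      linarith
    exact mul_le_mul a p3 (by positivity) (by positivity)
  have n3 : ((10 * E + 1 / 2) / N) * (R ^ 2 / Real.sqrt (1 / 2 - R)) ≤ ((10 * E₀ + 1 / 2) / N₀) * (R₀ ^ 2 / q) :=
    mul_le_mul d2 q2 (by positivity) (by positivity)
  have hnum0 : 0 ≤ (5 * E₀ + 1 / 4) * R₀ ^ 2 + D₀ * (10 * E₀ + 1 / 2) * R₀ ^ 3 + ((10 * E₀ + 1 / 2) / N₀) * (R₀ ^ 2 / q) := by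
    positivity
  have hfrac : ((5 * E + 1 / 4) * R ^ 2 + D * (10 * E + 1 / 2) * R ^ 3 + ((10 * E + 1 / 2) / N) * (R ^ 2 / Real.sqrt (1 / 2 - R)))
      / (1 / 2 - R) ≤
      ((5 * E₀ + 1 / 4) * R₀ ^ 2 + D₀ * (10 * E₀ + 1 / 2) * R₀ ^ 3 + ((10 * E₀ + 1 / 2) / N₀) * (R₀ ^ 2 / q)) / (1 / 2 - R₀) :=
    div_le_div₀ hnum0 (by linarith only [n1, n2, n3]) hT₀ (by linarith only [hRR₀])
  have hbody0 : 0 ≤ 1 + E * R + 2 * D * (E + 1 / 4) * R ^ 2 + 2 * ((E + 1 / 4) / N) * (R / Real.sqrt (1 / 2 - R))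
      + ((5 * E + 1 / 4) * R ^ 2 + D * (10 * E + 1 / 2) * R ^ 3 + ((10 * E + 1 / 2) / N) * (R ^ 2 / Real.sqrt (1 / 2 - R)))
        / (1 / 2 - R) := by positivity
  exact mul_le_mul hC (by linarith only [t1, t2, t3, hfrac]) hbody0 hC₀0

/-- **`MassGapAt 4 N x` for every `N ≥ 4` at every 't Hooft `|x| ≤ 33 / 1000`** (`0.033`), hypothesis-free, by the DS route (star door)
with the refined level-two one-link modulus. [folklore] -/
theorem massGapAt_SU_levelTwoR_four (hN : 4 ≤ N) {x : ℝ} (h : |x| ≤ 33 / 1000) : MassGapAt 4 N x := by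
  have hx0 : 0 ≤ |x| := abs_nonneg x
  have hR : |x| * 6 < 1 / 2 := by linarith
  have hN3 : 3 ≤ N := by omega
  have hx6 : 0 ≤ |x| * 6 := by positivity
  have hK := levelTwoRK_le (N₀ := 4) (N := N) (by norm_num) hN (R := |x| * 6) (R₀ := 99 / 500) (q := 1099 / 2000)
    hx6 (by linarith) (by norm_num) (by norm_num) (by norm_num)
  have hK0 : 0 ≤ (N : ℝ) ^ 2 / ((N : ℝ) ^ 2 - 1) *
        (1 + ((N : ℝ) ^ 2 / (2 * ((N : ℝ) ^ 2 - 4))) * (|x| * 6) + 2 * (((N : ℝ) ^ 2 / ((N : ℝ) ^ 2 - 1)) * (1 + 1 / ((N : ℝ) * ((N : ℝ) * (1 / 2 - (|x| * 6))))) / (1 - 2 * ((N : ℝ) ^ 2 / ((N : ℝ) ^ 2 - 1)) ^ 2 * (|x| * 6) ^ 2)) * (((N : ℝ) ^ 2 / (2 * ((N : ℝ) ^ 2 - 4))) + 1 / 4) * (|x| * 6) ^ 2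
          + 2 * ((((N : ℝ) ^ 2 / (2 * ((N : ℝ) ^ 2 - 4))) + 1 / 4) / N) * ((|x| * 6) / Real.sqrt (1 / 2 - (|x| * 6)))
          + ((5 * ((N : ℝ) ^ 2 / (2 * ((N : ℝ) ^ 2 - 4))) + 1 / 4) * (|x| * 6) ^ 2 + (((N : ℝ) ^ 2 / ((N : ℝ) ^ 2 - 1)) * (1 + 1 / ((N : ℝ) * ((N : ℝ) * (1 / 2 - (|x| * 6))))) / (1 - 2 * ((N : ℝ) ^ 2 / ((N : ℝ) ^ 2 - 1)) ^ 2 * (|x| * 6) ^ 2)) * (10 * ((N : ℝ) ^ 2 / (2 * ((N : ℝ) ^ 2 - 4))) + 1 / 2) * (|x| * 6) ^ 3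
              + ((10 * ((N : ℝ) ^ 2 / (2 * ((N : ℝ) ^ 2 - 4))) + 1 / 2) / N) * ((|x| * 6) ^ 2 / Real.sqrt (1 / 2 - (|x| * 6)))) / (1 / 2 - (|x| * 6))) := by
    have h10 : (4 : ℝ) ≤ N := by exact_mod_cast hN
    have hN4 : (0 : ℝ) < (N : ℝ) ^ 2 - 4 := by nlinarith
    have hN1 : (0 : ℝ) < (N : ℝ) ^ 2 - 1 := by nlinarith
    have : 0 ≤ (N : ℝ) ^ 2 / ((N : ℝ) ^ 2 - 1) := div_nonneg (by positivity) hN1.le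
    have : 0 ≤ (N : ℝ) ^ 2 / (2 * ((N : ℝ) ^ 2 - 4)) := div_nonneg (by positivity) (by positivity)
    have : 0 < 1 / 2 - |x| * 6 := by linarith
    obtain ⟨hD0, -⟩ := levelTwoR_Dm_mono (N := N) hN3 hx6 le_rfl hR
    positivity
  refine star_massGapAt_of_oneLinkKRModulus (by omega) hK0 le_rfl (oneLinkKRModulus_levelTwoR hN3 hR) ?_
  have hnum : ((4 : ℝ) ^ 2 / ((4 : ℝ) ^ 2 - 1)) *
        (1 + ((4 : ℝ) ^ 2 / (2 * ((4 : ℝ) ^ 2 - 4))) * (99 / 500) + 2 * (((4 : ℝ) ^ 2 / ((4 : ℝ) ^ 2 - 1)) * (1 + 1 / ((4 : ℝ) * ((4 : ℝ) * (1 / 2 - (99 / 500))))) / (1 - 2 * ((4 : ℝ) ^ 2 / ((4 : ℝ) ^ 2 - 1)) ^ 2 * (99 / 500) ^ 2)) * (((4 : ℝ) ^ 2 / (2 * ((4 : ℝ) ^ 2 - 4))) + 1 / 4) * (99 / 500) ^ 2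
          + 2 * ((((4 : ℝ) ^ 2 / (2 * ((4 : ℝ) ^ 2 - 4))) + 1 / 4) / (4 : ℝ)) * ((99 / 500) / (1099 / 2000))
          + ((5 * ((4 : ℝ) ^ 2 / (2 * ((4 : ℝ) ^ 2 - 4))) + 1 / 4) * (99 / 500) ^ 2 + (((4 : ℝ) ^ 2 / ((4 : ℝ) ^ 2 - 1)) * (1 + 1 / ((4 : ℝ) * ((4 : ℝ) * (1 / 2 - (99 / 500))))) / (1 - 2 * ((4 : ℝ) ^ 2 / ((4 : ℝ) ^ 2 - 1)) ^ 2 * (99 / 500) ^ 2)) * (10 * ((4 : ℝ) ^ 2 / (2 * ((4 : ℝ) ^ 2 - 4))) + 1 / 2) * (99 / 500) ^ 3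
              + ((10 * ((4 : ℝ) ^ 2 / (2 * ((4 : ℝ) ^ 2 - 4))) + 1 / 2) / (4 : ℝ)) * ((99 / 500) ^ 2 / (1099 / 2000))) / (1 / 2 - (99 / 500))) * (33 / 1000) ≤ 9 / 100 := by
    norm_num
  push_cast at hK
  nlinarith [mul_le_mul hK h (abs_nonneg x) (by norm_num), hK0]

/-- **`ImprovedThreshold 4 N (33 / 1000)` for every `N ≥ 4`, hypothesis-free** (`0.033`). [folklore] -/
theorem improvedThreshold_SU_levelTwoR_four (hN : 4 ≤ N) : ImprovedThreshold 4 N (33 / 1000) :=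
  ⟨by norm_num, fun _ hx => massGapAt_SU_levelTwoR_four hN hx.le⟩

/-- **`MassGapAt 4 N x` for every `N ≥ 6` at every 't Hooft `|x| ≤ 9 / 250`** (`0.036`), hypothesis-free, by the DS route (star door)
with the refined level-two one-link modulus. [folklore] -/
theorem massGapAt_SU_levelTwoR_six (hN : 6 ≤ N) {x : ℝ} (h : |x| ≤ 9 / 250) : MassGapAt 4 N x := by
  have hx0 : 0 ≤ |x| := abs_nonneg x
  have hR : |x| * 6 < 1 / 2 := by linarith
  have hN3 : 3 ≤ N := by omega
  have hx6 : 0 ≤ |x| * 6 := by positivity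
  have hK := levelTwoRK_le (N₀ := 6) (N := N) (by norm_num) hN (R := |x| * 6) (R₀ := 27 / 125) (q := 5329 / 10000)
    hx6 (by linarith) (by norm_num) (by norm_num) (by norm_num)
  have hK0 : 0 ≤ (N : ℝ) ^ 2 / ((N : ℝ) ^ 2 - 1) *
        (1 + ((N : ℝ) ^ 2 / (2 * ((N : ℝ) ^ 2 - 4))) * (|x| * 6) + 2 * (((N : ℝ) ^ 2 / ((N : ℝ) ^ 2 - 1)) * (1 + 1 / ((N : ℝ) * ((N : ℝ) * (1 / 2 - (|x| * 6))))) / (1 - 2 * ((N : ℝ) ^ 2 / ((N : ℝ) ^ 2 - 1)) ^ 2 * (|x| * 6) ^ 2)) * (((N : ℝ) ^ 2 / (2 * ((N : ℝ) ^ 2 - 4))) + 1 / 4) * (|x| * 6) ^ 2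
          + 2 * ((((N : ℝ) ^ 2 / (2 * ((N : ℝ) ^ 2 - 4))) + 1 / 4) / N) * ((|x| * 6) / Real.sqrt (1 / 2 - (|x| * 6)))
          + ((5 * ((N : ℝ) ^ 2 / (2 * ((N : ℝ) ^ 2 - 4))) + 1 / 4) * (|x| * 6) ^ 2 + (((N : ℝ) ^ 2 / ((N : ℝ) ^ 2 - 1)) * (1 + 1 / ((N : ℝ) * ((N : ℝ) * (1 / 2 - (|x| * 6))))) / (1 - 2 * ((N : ℝ) ^ 2 / ((N : ℝ) ^ 2 - 1)) ^ 2 * (|x| * 6) ^ 2)) * (10 * ((N : ℝ) ^ 2 / (2 * ((N : ℝ) ^ 2 - 4))) + 1 / 2) * (|x| * 6) ^ 3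
              + ((10 * ((N : ℝ) ^ 2 / (2 * ((N : ℝ) ^ 2 - 4))) + 1 / 2) / N) * ((|x| * 6) ^ 2 / Real.sqrt (1 / 2 - (|x| * 6)))) / (1 / 2 - (|x| * 6))) := by
    have h10 : (6 : ℝ) ≤ N := by exact_mod_cast hN
    have hN4 : (0 : ℝ) < (N : ℝ) ^ 2 - 4 := by nlinarith
    have hN1 : (0 : ℝ) < (N : ℝ) ^ 2 - 1 := by nlinarith
    have : 0 ≤ (N : ℝ) ^ 2 / ((N : ℝ) ^ 2 - 1) := div_nonneg (by positivity) hN1.le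
    have : 0 ≤ (N : ℝ) ^ 2 / (2 * ((N : ℝ) ^ 2 - 4)) := div_nonneg (by positivity) (by positivity)
    have : 0 < 1 / 2 - |x| * 6 := by linarith
    obtain ⟨hD0, -⟩ := levelTwoR_Dm_mono (N := N) hN3 hx6 le_rfl hR
    positivity
  refine star_massGapAt_of_oneLinkKRModulus (by omega) hK0 le_rfl (oneLinkKRModulus_levelTwoR hN3 hR) ?_
  have hnum : ((6 : ℝ) ^ 2 / ((6 : ℝ) ^ 2 - 1)) *
        (1 + ((6 : ℝ) ^ 2 / (2 * ((6 : ℝ) ^ 2 - 4))) * (27 / 125) + 2 * (((6 : ℝ) ^ 2 / ((6 : ℝ) ^ 2 - 1)) * (1 + 1 / ((6 : ℝ) * ((6 : ℝ) * (1 / 2 - (27 / 125))))) / (1 - 2 * ((6 : ℝ) ^ 2 / ((6 : ℝ) ^ 2 - 1)) ^ 2 * (27 / 125) ^ 2)) * (((6 : ℝ) ^ 2 / (2 * ((6 : ℝ) ^ 2 - 4))) + 1 / 4) * (27 / 125) ^ 2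
          + 2 * ((((6 : ℝ) ^ 2 / (2 * ((6 : ℝ) ^ 2 - 4))) + 1 / 4) / (6 : ℝ)) * ((27 / 125) / (5329 / 10000))
          + ((5 * ((6 : ℝ) ^ 2 / (2 * ((6 : ℝ) ^ 2 - 4))) + 1 / 4) * (27 / 125) ^ 2 + (((6 : ℝ) ^ 2 / ((6 : ℝ) ^ 2 - 1)) * (1 + 1 / ((6 : ℝ) * ((6 : ℝ) * (1 / 2 - (27 / 125))))) / (1 - 2 * ((6 : ℝ) ^ 2 / ((6 : ℝ) ^ 2 - 1)) ^ 2 * (27 / 125) ^ 2)) * (10 * ((6 : ℝ) ^ 2 / (2 * ((6 : ℝ) ^ 2 - 4))) + 1 / 2) * (27 / 125) ^ 3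
              + ((10 * ((6 : ℝ) ^ 2 / (2 * ((6 : ℝ) ^ 2 - 4))) + 1 / 2) / (6 : ℝ)) * ((27 / 125) ^ 2 / (5329 / 10000))) / (1 / 2 - (27 / 125))) * (9 / 250) ≤ 9 / 100 := by
    norm_num
  push_cast at hK
  nlinarith [mul_le_mul hK h (abs_nonneg x) (by norm_num), hK0]

/-- **`ImprovedThreshold 4 N (9 / 250)` for every `N ≥ 6`, hypothesis-free** (`0.036`). [folklore] -/
theorem improvedThreshold_SU_levelTwoR_six (hN : 6 ≤ N) : ImprovedThreshold 4 N (9 / 250) :=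
  ⟨by norm_num, fun _ hx => massGapAt_SU_levelTwoR_six hN hx.le⟩

/-- **`MassGapAt 4 N x` for every `N ≥ 10` at every 't Hooft `|x| ≤ 19 / 500`** (`0.038`), hypothesis-free, by the DS route (star door)
with the refined level-two one-link modulus. [folklore] -/
theorem massGapAt_SU_levelTwoR_ten (hN : 10 ≤ N) {x : ℝ} (h : |x| ≤ 19 / 500) : MassGapAt 4 N x := by
  have hx0 : 0 ≤ |x| := abs_nonneg x
  have hR : |x| * 6 < 1 / 2 := by linarith
  have hN3 : 3 ≤ N := by omega
  have hx6 : 0 ≤ |x| * 6 := by positivity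
  have hK := levelTwoRK_le (N₀ := 10) (N := N) (by norm_num) hN (R := |x| * 6) (R₀ := 57 / 250) (q := 1043 / 2000)
    hx6 (by linarith) (by norm_num) (by norm_num) (by norm_num)
  have hK0 : 0 ≤ (N : ℝ) ^ 2 / ((N : ℝ) ^ 2 - 1) *
        (1 + ((N : ℝ) ^ 2 / (2 * ((N : ℝ) ^ 2 - 4))) * (|x| * 6) + 2 * (((N : ℝ) ^ 2 / ((N : ℝ) ^ 2 - 1)) * (1 + 1 / ((N : ℝ) * ((N : ℝ) * (1 / 2 - (|x| * 6))))) / (1 - 2 * ((N : ℝ) ^ 2 / ((N : ℝ) ^ 2 - 1)) ^ 2 * (|x| * 6) ^ 2)) * (((N : ℝ) ^ 2 / (2 * ((N : ℝ) ^ 2 - 4))) + 1 / 4) * (|x| * 6) ^ 2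
          + 2 * ((((N : ℝ) ^ 2 / (2 * ((N : ℝ) ^ 2 - 4))) + 1 / 4) / N) * ((|x| * 6) / Real.sqrt (1 / 2 - (|x| * 6)))
          + ((5 * ((N : ℝ) ^ 2 / (2 * ((N : ℝ) ^ 2 - 4))) + 1 / 4) * (|x| * 6) ^ 2 + (((N : ℝ) ^ 2 / ((N : ℝ) ^ 2 - 1)) * (1 + 1 / ((N : ℝ) * ((N : ℝ) * (1 / 2 - (|x| * 6))))) / (1 - 2 * ((N : ℝ) ^ 2 / ((N : ℝ) ^ 2 - 1)) ^ 2 * (|x| * 6) ^ 2)) * (10 * ((N : ℝ) ^ 2 / (2 * ((N : ℝ) ^ 2 - 4))) + 1 / 2) * (|x| * 6) ^ 3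
              + ((10 * ((N : ℝ) ^ 2 / (2 * ((N : ℝ) ^ 2 - 4))) + 1 / 2) / N) * ((|x| * 6) ^ 2 / Real.sqrt (1 / 2 - (|x| * 6)))) / (1 / 2 - (|x| * 6))) := by
    have h10 : (10 : ℝ) ≤ N := by exact_mod_cast hN
    have hN4 : (0 : ℝ) < (N : ℝ) ^ 2 - 4 := by nlinarith
    have hN1 : (0 : ℝ) < (N : ℝ) ^ 2 - 1 := by nlinarith
    have : 0 ≤ (N : ℝ) ^ 2 / ((N : ℝ) ^ 2 - 1) := div_nonneg (by positivity) hN1.le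
    have : 0 ≤ (N : ℝ) ^ 2 / (2 * ((N : ℝ) ^ 2 - 4)) := div_nonneg (by positivity) (by positivity)
    have : 0 < 1 / 2 - |x| * 6 := by linarith
    obtain ⟨hD0, -⟩ := levelTwoR_Dm_mono (N := N) hN3 hx6 le_rfl hR
    positivity
  refine star_massGapAt_of_oneLinkKRModulus (by omega) hK0 le_rfl (oneLinkKRModulus_levelTwoR hN3 hR) ?_
  have hnum : ((10 : ℝ) ^ 2 / ((10 : ℝ) ^ 2 - 1)) *
        (1 + ((10 : ℝ) ^ 2 / (2 * ((10 : ℝ) ^ 2 - 4))) * (57 / 250) + 2 * (((10 : ℝ) ^ 2 / ((10 : ℝ) ^ 2 - 1)) * (1 + 1 / ((10 : ℝ) * ((10 : ℝ) * (1 / 2 - (57 / 250))))) / (1 - 2 * ((10 : ℝ) ^ 2 / ((10 : ℝ) ^ 2 - 1)) ^ 2 * (57 / 250) ^ 2)) * (((10 : ℝ) ^ 2 / (2 * ((10 : ℝ) ^ 2 - 4))) + 1 / 4) * (57 / 250) ^ 2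
          + 2 * ((((10 : ℝ) ^ 2 / (2 * ((10 : ℝ) ^ 2 - 4))) + 1 / 4) / (10 : ℝ)) * ((57 / 250) / (1043 / 2000))
          + ((5 * ((10 : ℝ) ^ 2 / (2 * ((10 : ℝ) ^ 2 - 4))) + 1 / 4) * (57 / 250) ^ 2 + (((10 : ℝ) ^ 2 / ((10 : ℝ) ^ 2 - 1)) * (1 + 1 / ((10 : ℝ) * ((10 : ℝ) * (1 / 2 - (57 / 250))))) / (1 - 2 * ((10 : ℝ) ^ 2 / ((10 : ℝ) ^ 2 - 1)) ^ 2 * (57 / 250) ^ 2)) * (10 * ((10 : ℝ) ^ 2 / (2 * ((10 : ℝ) ^ 2 - 4))) + 1 / 2) * (57 / 250) ^ 3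
              + ((10 * ((10 : ℝ) ^ 2 / (2 * ((10 : ℝ) ^ 2 - 4))) + 1 / 2) / (10 : ℝ)) * ((57 / 250) ^ 2 / (1043 / 2000))) / (1 / 2 - (57 / 250))) * (19 / 500) ≤ 9 / 100 := by
    norm_num
  push_cast at hK
  nlinarith [mul_le_mul hK h (abs_nonneg x) (by norm_num), hK0]

/-- **`ImprovedThreshold 4 N (19 / 500)` for every `N ≥ 10`, hypothesis-free** (`0.038`). [folklore] -/
theorem improvedThreshold_SU_levelTwoR_ten (hN : 10 ≤ N) : ImprovedThreshold 4 N (19 / 500) :=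
  ⟨by norm_num, fun _ hx => massGapAt_SU_levelTwoR_ten hN hx.le⟩

/-- **`MassGapAt 4 N x` for every `N ≥ 20` at every 't Hooft `|x| ≤ 39 / 1000`** (`0.039`), hypothesis-free, by the DS route (star door)
with the refined level-two one-link modulus. [folklore] -/
theorem massGapAt_SU_levelTwoR_twenty (hN : 20 ≤ N) {x : ℝ} (h : |x| ≤ 39 / 1000) : MassGapAt 4 N x := by
  have hx0 : 0 ≤ |x| := abs_nonneg x
  have hR : |x| * 6 < 1 / 2 := by linarith
  have hN3 : 3 ≤ N := by omega
  have hx6 : 0 ≤ |x| * 6 := by positivity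
  have hK := levelTwoRK_le (N₀ := 20) (N := N) (by norm_num) hN (R := |x| * 6) (R₀ := 117 / 500) (q := 5157 / 10000)
    hx6 (by linarith) (by norm_num) (by norm_num) (by norm_num)
  have hK0 : 0 ≤ (N : ℝ) ^ 2 / ((N : ℝ) ^ 2 - 1) *
        (1 + ((N : ℝ) ^ 2 / (2 * ((N : ℝ) ^ 2 - 4))) * (|x| * 6) + 2 * (((N : ℝ) ^ 2 / ((N : ℝ) ^ 2 - 1)) * (1 + 1 / ((N : ℝ) * ((N : ℝ) * (1 / 2 - (|x| * 6))))) / (1 - 2 * ((N : ℝ) ^ 2 / ((N : ℝ) ^ 2 - 1)) ^ 2 * (|x| * 6) ^ 2)) * (((N : ℝ) ^ 2 / (2 * ((N : ℝ) ^ 2 - 4))) + 1 / 4) * (|x| * 6) ^ 2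
          + 2 * ((((N : ℝ) ^ 2 / (2 * ((N : ℝ) ^ 2 - 4))) + 1 / 4) / N) * ((|x| * 6) / Real.sqrt (1 / 2 - (|x| * 6)))
          + ((5 * ((N : ℝ) ^ 2 / (2 * ((N : ℝ) ^ 2 - 4))) + 1 / 4) * (|x| * 6) ^ 2 + (((N : ℝ) ^ 2 / ((N : ℝ) ^ 2 - 1)) * (1 + 1 / ((N : ℝ) * ((N : ℝ) * (1 / 2 - (|x| * 6))))) / (1 - 2 * ((N : ℝ) ^ 2 / ((N : ℝ) ^ 2 - 1)) ^ 2 * (|x| * 6) ^ 2)) * (10 * ((N : ℝ) ^ 2 / (2 * ((N : ℝ) ^ 2 - 4))) + 1 / 2) * (|x| * 6) ^ 3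
              + ((10 * ((N : ℝ) ^ 2 / (2 * ((N : ℝ) ^ 2 - 4))) + 1 / 2) / N) * ((|x| * 6) ^ 2 / Real.sqrt (1 / 2 - (|x| * 6)))) / (1 / 2 - (|x| * 6))) := by
    have h10 : (20 : ℝ) ≤ N := by exact_mod_cast hN
    have hN4 : (0 : ℝ) < (N : ℝ) ^ 2 - 4 := by nlinarith
    have hN1 : (0 : ℝ) < (N : ℝ) ^ 2 - 1 := by nlinarith
    have : 0 ≤ (N : ℝ) ^ 2 / ((N : ℝ) ^ 2 - 1) := div_nonneg (by positivity) hN1.le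
    have : 0 ≤ (N : ℝ) ^ 2 / (2 * ((N : ℝ) ^ 2 - 4)) := div_nonneg (by positivity) (by positivity)
    have : 0 < 1 / 2 - |x| * 6 := by linarith
    obtain ⟨hD0, -⟩ := levelTwoR_Dm_mono (N := N) hN3 hx6 le_rfl hR
    positivity
  refine star_massGapAt_of_oneLinkKRModulus (by omega) hK0 le_rfl (oneLinkKRModulus_levelTwoR hN3 hR) ?_
  have hnum : ((20 : ℝ) ^ 2 / ((20 : ℝ) ^ 2 - 1)) *
        (1 + ((20 : ℝ) ^ 2 / (2 * ((20 : ℝ) ^ 2 - 4))) * (117 / 500) + 2 * (((20 : ℝ) ^ 2 / ((20 : ℝ) ^ 2 - 1)) * (1 + 1 / ((20 : ℝ) * ((20 : ℝ) * (1 / 2 - (117 / 500))))) / (1 - 2 * ((20 : ℝ) ^ 2 / ((20 : ℝ) ^ 2 - 1)) ^ 2 * (117 / 500) ^ 2)) * (((20 : ℝ) ^ 2 / (2 * ((20 : ℝ) ^ 2 - 4))) + 1 / 4) * (117 / 500) ^ 2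
          + 2 * ((((20 : ℝ) ^ 2 / (2 * ((20 : ℝ) ^ 2 - 4))) + 1 / 4) / (20 : ℝ)) * ((117 / 500) / (5157 / 10000))
          + ((5 * ((20 : ℝ) ^ 2 / (2 * ((20 : ℝ) ^ 2 - 4))) + 1 / 4) * (117 / 500) ^ 2 + (((20 : ℝ) ^ 2 / ((20 : ℝ) ^ 2 - 1)) * (1 + 1 / ((20 : ℝ) * ((20 : ℝ) * (1 / 2 - (117 / 500))))) / (1 - 2 * ((20 : ℝ) ^ 2 / ((20 : ℝ) ^ 2 - 1)) ^ 2 * (117 / 500) ^ 2)) * (10 * ((20 : ℝ) ^ 2 / (2 * ((20 : ℝ) ^ 2 - 4))) + 1 / 2) * (117 / 500) ^ 3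
              + ((10 * ((20 : ℝ) ^ 2 / (2 * ((20 : ℝ) ^ 2 - 4))) + 1 / 2) / (20 : ℝ)) * ((117 / 500) ^ 2 / (5157 / 10000))) / (1 / 2 - (117 / 500))) * (39 / 1000) ≤ 9 / 100 := by
    norm_num
  push_cast at hK
  nlinarith [mul_le_mul hK h (abs_nonneg x) (by norm_num), hK0]

/-- **`ImprovedThreshold 4 N (39 / 1000)` for every `N ≥ 20`, hypothesis-free** (`0.039`). [folklore] -/
theorem improvedThreshold_SU_levelTwoR_twenty (hN : 20 ≤ N) : ImprovedThreshold 4 N (39 / 1000) :=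
  ⟨by norm_num, fun _ hx => massGapAt_SU_levelTwoR_twenty hN hx.le⟩

/-- **`MassGapAt 4 N x` for every `N ≥ 50` at every 't Hooft `|x| ≤ 1 / 25`** (`0.040`), hypothesis-free, by the DS route (star door)
with the refined level-two one-link modulus. [folklore] -/
theorem massGapAt_SU_levelTwoR_fifty (hN : 50 ≤ N) {x : ℝ} (h : |x| ≤ 1 / 25) : MassGapAt 4 N x := by
  have hx0 : 0 ≤ |x| := abs_nonneg x
  have hR : |x| * 6 < 1 / 2 := by linarith
  have hN3 : 3 ≤ N := by omega
  have hx6 : 0 ≤ |x| * 6 := by positivity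
  have hK := levelTwoRK_le (N₀ := 50) (N := N) (by norm_num) hN (R := |x| * 6) (R₀ := 6 / 25) (q := 5099 / 10000)
    hx6 (by linarith) (by norm_num) (by norm_num) (by norm_num)
  have hK0 : 0 ≤ (N : ℝ) ^ 2 / ((N : ℝ) ^ 2 - 1) *
        (1 + ((N : ℝ) ^ 2 / (2 * ((N : ℝ) ^ 2 - 4))) * (|x| * 6) + 2 * (((N : ℝ) ^ 2 / ((N : ℝ) ^ 2 - 1)) * (1 + 1 / ((N : ℝ) * ((N : ℝ) * (1 / 2 - (|x| * 6))))) / (1 - 2 * ((N : ℝ) ^ 2 / ((N : ℝ) ^ 2 - 1)) ^ 2 * (|x| * 6) ^ 2)) * (((N : ℝ) ^ 2 / (2 * ((N : ℝ) ^ 2 - 4))) + 1 / 4) * (|x| * 6) ^ 2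
          + 2 * ((((N : ℝ) ^ 2 / (2 * ((N : ℝ) ^ 2 - 4))) + 1 / 4) / N) * ((|x| * 6) / Real.sqrt (1 / 2 - (|x| * 6)))
          + ((5 * ((N : ℝ) ^ 2 / (2 * ((N : ℝ) ^ 2 - 4))) + 1 / 4) * (|x| * 6) ^ 2 + (((N : ℝ) ^ 2 / ((N : ℝ) ^ 2 - 1)) * (1 + 1 / ((N : ℝ) * ((N : ℝ) * (1 / 2 - (|x| * 6))))) / (1 - 2 * ((N : ℝ) ^ 2 / ((N : ℝ) ^ 2 - 1)) ^ 2 * (|x| * 6) ^ 2)) * (10 * ((N : ℝ) ^ 2 / (2 * ((N : ℝ) ^ 2 - 4))) + 1 / 2) * (|x| * 6) ^ 3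
              + ((10 * ((N : ℝ) ^ 2 / (2 * ((N : ℝ) ^ 2 - 4))) + 1 / 2) / N) * ((|x| * 6) ^ 2 / Real.sqrt (1 / 2 - (|x| * 6)))) / (1 / 2 - (|x| * 6))) := by
    have h10 : (50 : ℝ) ≤ N := by exact_mod_cast hN
    have hN4 : (0 : ℝ) < (N : ℝ) ^ 2 - 4 := by nlinarith
    have hN1 : (0 : ℝ) < (N : ℝ) ^ 2 - 1 := by nlinarith
    have : 0 ≤ (N : ℝ) ^ 2 / ((N : ℝ) ^ 2 - 1) := div_nonneg (by positivity) hN1.le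
    have : 0 ≤ (N : ℝ) ^ 2 / (2 * ((N : ℝ) ^ 2 - 4)) := div_nonneg (by positivity) (by positivity)
    have : 0 < 1 / 2 - |x| * 6 := by linarith
    obtain ⟨hD0, -⟩ := levelTwoR_Dm_mono (N := N) hN3 hx6 le_rfl hR
    positivity
  refine star_massGapAt_of_oneLinkKRModulus (by omega) hK0 le_rfl (oneLinkKRModulus_levelTwoR hN3 hR) ?_
  have hnum : ((50 : ℝ) ^ 2 / ((50 : ℝ) ^ 2 - 1)) *
        (1 + ((50 : ℝ) ^ 2 / (2 * ((50 : ℝ) ^ 2 - 4))) * (6 / 25) + 2 * (((50 : ℝ) ^ 2 / ((50 : ℝ) ^ 2 - 1)) * (1 + 1 / ((50 : ℝ) * ((50 : ℝ) * (1 / 2 - (6 / 25))))) / (1 - 2 * ((50 : ℝ) ^ 2 / ((50 : ℝ) ^ 2 - 1)) ^ 2 * (6 / 25) ^ 2)) * (((50 : ℝ) ^ 2 / (2 * ((50 : ℝ) ^ 2 - 4))) + 1 / 4) * (6 / 25) ^ 2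
          + 2 * ((((50 : ℝ) ^ 2 / (2 * ((50 : ℝ) ^ 2 - 4))) + 1 / 4) / (50 : ℝ)) * ((6 / 25) / (5099 / 10000))
          + ((5 * ((50 : ℝ) ^ 2 / (2 * ((50 : ℝ) ^ 2 - 4))) + 1 / 4) * (6 / 25) ^ 2 + (((50 : ℝ) ^ 2 / ((50 : ℝ) ^ 2 - 1)) * (1 + 1 / ((50 : ℝ) * ((50 : ℝ) * (1 / 2 - (6 / 25))))) / (1 - 2 * ((50 : ℝ) ^ 2 / ((50 : ℝ) ^ 2 - 1)) ^ 2 * (6 / 25) ^ 2)) * (10 * ((50 : ℝ) ^ 2 / (2 * ((50 : ℝ) ^ 2 - 4))) + 1 / 2) * (6 / 25) ^ 3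
              + ((10 * ((50 : ℝ) ^ 2 / (2 * ((50 : ℝ) ^ 2 - 4))) + 1 / 2) / (50 : ℝ)) * ((6 / 25) ^ 2 / (5099 / 10000))) / (1 / 2 - (6 / 25))) * (1 / 25) ≤ 9 / 100 := by
    norm_num
  push_cast at hK
  nlinarith [mul_le_mul hK h (abs_nonneg x) (by norm_num), hK0]

/-- **`ImprovedThreshold 4 N (1 / 25)` for every `N ≥ 50`, hypothesis-free** (`0.040`). [folklore] -/
theorem improvedThreshold_SU_levelTwoR_fifty (hN : 50 ≤ N) : ImprovedThreshold 4 N (1 / 25) :=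
  ⟨by norm_num, fun _ hx => massGapAt_SU_levelTwoR_fifty hN hx.le⟩

/-- The refined numbers: `1/32 < 33/1000 < 9/250 < 19/500 < 39/1000 < 1/25` and the crude level-two rows they supersede
(`69/2000 < 9/250`, `73/2000 < 19/500`, `3/80 < 39/1000`, `19/500 < 1/25`). [folklore] -/
theorem threshold_numbers_levelTwoR :
    (1 : ℝ) / 32 < 33 / 1000 ∧ (33 : ℝ) / 1000 < 9 / 250 ∧ (9 : ℝ) / 250 < 19 / 500 ∧ (19 : ℝ) / 500 < 39 / 1000 ∧
      (39 : ℝ) / 1000 < 1 / 25 ∧ (69 : ℝ) / 2000 < 9 / 250 ∧ (73 : ℝ) / 2000 < 19 / 500 ∧ (3 : ℝ) / 80 < 39 / 1000 := by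
  norm_num

end LevelTwoRRows

end Summit.Ventures.YMGap.OneLinkEigen
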